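import Summits.BirchSwinnertonDyer.Rank1Residual.AdditivePotMult.QuadraticBaseChangeDescentUnramifiedFact
import Summits.BirchSwinnertonDyer.Rank1Residual.AdditivePotMult.QuadraticBaseChangeMilneQuotientOddPartDischarge
import Literature.NumberTheory.DiophantineGeometry.KodairaSymbolUnramifiedBaseChangeProofs
import HarnessLib

/-!
# The S₃ ENDs of the base-change-and-descend route WITHOUT the hypothesis `hA` (`p ≥ 5` family)
# (row T-MIL-3, FILE H-4a; filed by seat n1011-p01 GEN 8 per lead R5-84 (j) / referee-1 ACK-1 T-MIL-3
# proviso (vi), from the draft offered by n1011-p16 GEN 10 (row T-A233, `…DescentUnramified.offer.lean`))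

HONEST FRAMING (cell `b2b-bsdres`, run/shared/lean/b2b/bsd-rank1-residual/, verbatim in every
file): the goal of the cell is to DELETE the COMBINATION-SHAPED residual classes of the
Birch–Swinnerton-Dyer formula for ALL analytic-rank `≤ 1` elliptic curves over `ℚ` — "full BSD
formula for every rank `≤ 1` curve in class `C`" assembled STRICTLY from published theorems — so
that the rank-`≤ 1` remainder becomes exactly the CONSTRUCTION-SHAPED classes, which are TYPED
(missing-input `Prop`s), NOT attempted. This is not "finishing BSD". Sub-classes X3♯(M) / X4(M)
(additive, potentially multiplicative prime; base-change-and-descend): a RESEARCH ROUTE; they stay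
CONSTRUCTION-SHAPED; nothing is booked by this file; no mark / label moved. THEOREMS ONLY: no
definition, no named fact, no `sorry`.

## What

n1011-p01's S₃ files (T-MIL-ODD C-3h `padicValRat_norm_mul_tamagawaProduct_eq_of_unramifiedFact`,
C-4b `milneQuotient_ordp_of_unramifiedFact`, T-MIL-S3 G-1
`milneQuotient_ordp_of_unramifiedFact_imaginary` / `…_real` /
`bsdp_of_pPartOver_of_bsdp_twist_quadratic_of_unramifiedFact`) take the named fact A233
`Literature.NumberTheory.DiophantineGeometry.kodairaSymbolAt_baseChange_of_ramificationIdx_eq_one`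
(Tate's algorithm is insensitive to unramified base change) as a HYPOTHESIS `hA` at every pair of
places `(v, w)`.  A233 is now a THEOREM
(`Literature.NumberTheory.DiophantineGeometry.UnramifiedBaseChange.kodairaSymbolAt_baseChange_of_ramificationIdx_eq_one_holds`,
row T-A233, files U-1a … U-3).  This file feeds `hA := fun v w ↦ …_holds K v w W` and restates the
five ENDs WITHOUT `hA` — the C-3h / C-4b / G-1 files are not edited (referee-1 ACK-1 T-MIL-3 proviso
(vi), T-A233 proviso (v)); the statements are n1011-p16's offered one-liners, verbatim. The odd-`p`
family (row T-MIL-3 H-5a / H-5b / H-5c) is the sibling FILE H-4b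
(`QuadraticBaseChangeDescentUnramifiedOddPrime`).

* `unramifiedFact_rat` — `hA` itself, for every `W / ℚ` and every number field `K`;
* `padicValRat_norm_mul_tamagawaProduct_eq_of_addv_unramified` (C-3h END #4 without `hA`): the odd
  Tamagawa identity of Milne's quadratic BSD quotient on population S₃ (`W` good ∨ multiplicative ∨
  (`ℓ ∣ d_K` ∧ `W_d` multiplicative) ∨ (`W` additive ∧ `ℓ ∤ d_K`)), `p ≥ 5`;
* `milneQuotient_ordp_of_addv_unramified` (C-4b, rank zero), `…_imaginary`, `…_real` (G-1, total
  rank `≤ 1`);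
* `bsdp_of_pPartOver_of_bsdp_twist_quadratic_of_addv_unramified` (G-1 END without `hA`):
  `BSDp W p ⟸ MissingPPartOverAt W' p ∧ BSDp Wd p` on S₃ × {`p ≥ 5`} × {total analytic rank `≤ 1`}
  × {`d_K` odd squarefree, either signature}, hypotheses `hGZK`, `hmod` only.

HONEST LIMITS: exactly p01's statements minus `hA`; `p ≥ 5` (the `p = 3` entries of (T) at additive
places are row T-MIL-B's); even `d_K`, `p = 2`, total rank `≥ 2` not covered; X3♯(M)/X4(M) stay
CONSTRUCTION-SHAPED; closes no class; moves no mark; 0 facts (A233 is CONSUMED as a theorem, net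
registry debt −1 by U-3, nothing new here).

References: J. H. Silverman, *AEC* 2nd ed., Prop. VII.5.4 (a) [SilvermanAEC2009]; J. S. Milne,
Invent. Math. 17 (1972) §1 Thm. 1, §2 [Milne1972ArithmeticAV]; T. Dokchitser, V. Dokchitser, Ann.
of Math. 172 (2010) §2.1 [DokchitserDokchitserAnnals2010]; R. L. Miller, LMS J. Comput. Math. 14
(2011) Def. 1.1 [Miller2011LMS].
-/

noncomputable section

open scoped Classical NumberField

open WeierstrassCurve NumberField NumberField.InfinitePlace IsDedekindDomain Rat.HeightOneSpectrum
  Literature.NumberTheory.EllipticCurves Literature.NumberTheory.EllipticCurves.Rank1Residual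
  Literature.NumberTheory.EllipticCurves.Rank1Residual.Typed
  Literature.NumberTheory.DiophantineGeometry
  Literature.NumberTheory.DiophantineGeometry.UnramifiedBaseChange

namespace Summit.BirchSwinnertonDyer.Rank1Residual.AdditivePotMult

section Unramified

variable (W : WeierstrassCurve ℚ) [W.IsElliptic] [W.IsGloballyMinimal] (p : ℕ) [hp : Fact p.Prime]
  (K : Type) [Field K] [NumberField K]
  (Wd : WeierstrassCurve ℚ) [Wd.IsElliptic] [Wd.IsGloballyMinimal]
  (W' : WeierstrassCurve K) [W'.IsElliptic] [W'.IsGloballyMinimal]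

omit [W.IsElliptic] [W.IsGloballyMinimal] in
/-- **The hypothesis `hA` of p01's S₃ files is a theorem**: A233 at every pair of finite places
`(v, w)` of `(ℚ, K)`, from `kodairaSymbolAt_baseChange_of_ramificationIdx_eq_one_holds`.
[cite: SilvermanAEC2009, Prop. VII.5.4 (a) with proof (p. 197)] -/
theorem unramifiedFact_rat :
    ∀ (v : HeightOneSpectrum (𝓞 ℚ)) (w : HeightOneSpectrum (𝓞 K)),
      kodairaSymbolAt_baseChange_of_ramificationIdx_eq_one K v w W :=
  fun v w ↦ UnramifiedBaseChange.kodairaSymbolAt_baseChange_of_ramificationIdx_eq_one_holds K v w W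

omit [W'.IsElliptic] in
/-- **C-3h END #4 WITHOUT `hA`: the odd Tamagawa identity of Milne's quadratic BSD quotient on S₃,
`p ≥ 5`** — `v_p(|N_{K/ℚ}(C'.u)| · ∏_w c_w(W')) = v_p(|C_d.u| · ∏_v c_v(W) · ∏_v c_v(W_d))` for
`W/ℚ` globally minimal elliptic, `K` quadratic with `d_K` odd squarefree, globally minimal
`W_d = C_d • W^{(d_K)}`, `W' = C' • W_K`, and `hS : ∀ v`, `W` good ∨ multiplicative ∨ (`ℓ_v ∣ d_K` ∧
`W_d` multiplicative) ∨ (`W` additive ∧ `ℓ_v ∤ d_K`) (p01's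
`padicValRat_norm_mul_tamagawaProduct_eq_of_unramifiedFact` fed with `unramifiedFact_rat`).
[cite: Milne1972ArithmeticAV, §1 Thm. 1 and §2 (through DokchitserDokchitserAnnals2010, §2.1, proof of Thm. 8)] [cite: SilvermanAEC2009, Prop. VII.5.4 (a), Thm. VII.6.1] -/
theorem padicValRat_norm_mul_tamagawaProduct_eq_of_addv_unramified (h2 : Module.finrank ℚ K = 2)
    (hdodd : Odd (NumberField.discr K)) (hdsq : Squarefree (NumberField.discr K))
    {Cd : VariableChange ℚ} (hWd : Cd • W.quadraticTwist (NumberField.discr K : ℚ) = Wd)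
    {C' : VariableChange K} (hW' : C' • W.baseChange K = W')
    (hS : ∀ v : HeightOneSpectrum (𝓞 ℚ), W.HasGoodReductionAt v ∨ W.HasMultiplicativeReductionAt v ∨
      (((primesEquiv v : ℕ) : ℤ) ∣ NumberField.discr K ∧ Wd.HasMultiplicativeReductionAt v) ∨
      (W.HasAdditiveReductionAt v ∧ ¬ ((primesEquiv v : ℕ) : ℤ) ∣ NumberField.discr K))
    (hp5 : 5 ≤ p) :
    padicValRat p (|Algebra.norm ℚ (C'.u : K)| * W'.tamagawaProduct : ℚ) =
      padicValRat p (|(Cd.u : ℚ)| * (W.tamagawaProduct * Wd.tamagawaProduct) : ℚ) :=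
  padicValRat_norm_mul_tamagawaProduct_eq_of_unramifiedFact W K Wd W' h2 hdodd hdsq hWd hW'
    (unramifiedFact_rat W K) hS p hp5

/-- **C-4b WITHOUT `hA`: `hWR_p` on S₃, `p ≥ 5`, rank zero, imaginary `K`.**
[cite: Milne1972ArithmeticAV, §1 Thm. 1 and §2 (through DokchitserDokchitserAnnals2010, §2.1, proof of Thm. 8)] [cite: SilvermanAEC2009, Prop. VII.5.4 (a)] -/
theorem milneQuotient_ordp_of_addv_unramified [IsTotallyComplex K] (h2 : Module.finrank ℚ K = 2)
    (hdodd : Odd (NumberField.discr K)) (hdsq : Squarefree (NumberField.discr K))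
    {Cd : VariableChange ℚ} (hWd : Cd • W.quadraticTwist (NumberField.discr K : ℚ) = Wd)
    {C' : VariableChange K} (hW' : C' • W.baseChange K = W') [Finite W'.toAffine.Point]
    (hsha : W'.ShaFinite)
    (hS : ∀ v : HeightOneSpectrum (𝓞 ℚ), W.HasGoodReductionAt v ∨ W.HasMultiplicativeReductionAt v ∨
      (((primesEquiv v : ℕ) : ℤ) ∣ NumberField.discr K ∧ Wd.HasMultiplicativeReductionAt v) ∨
      (W.HasAdditiveReductionAt v ∧ ¬ ((primesEquiv v : ℕ) : ℤ) ∣ NumberField.discr K))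
    (hp5 : 5 ≤ p) :
    ∃ q : ℚ, 0 < q ∧ padicValRat p q = 0 ∧
      (W'.shaOrder : ℝ) * W'.regulator * W'.bsdPeriod * (W'.tamagawaProduct : ℝ) /
          (W'.torsionOrder : ℝ) ^ 2 = (q : ℝ) * (W.bsdRHS * Wd.bsdRHS) :=
  milneQuotient_ordp_of_unramifiedFact W K Wd W' h2 hdodd hdsq hWd hW' hsha (unramifiedFact_rat W K)
    hS p hp5

/-- **G-1 (imaginary) WITHOUT `hA`: `hWR_p` on S₃ at `p ≥ 5`, imaginary `K`, total rank `≤ 1`.**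
[cite: Milne1972ArithmeticAV, §1 Thm. 1 and §2 (through DokchitserDokchitserAnnals2010, §2.1, proof of Thm. 8)] [cite: SilvermanAEC2009, Prop. VII.5.4 (a)] -/
theorem milneQuotient_ordp_of_addv_unramified_imaginary [IsTotallyComplex K]
    (h2 : Module.finrank ℚ K = 2)
    (hdodd : Odd (NumberField.discr K)) (hdsq : Squarefree (NumberField.discr K))
    {Cd : VariableChange ℚ} (hWd : Cd • W.quadraticTwist (NumberField.discr K : ℚ) = Wd)
    {C' : VariableChange K} (hW' : C' • W.baseChange K = W') [Finite W.sha] [Finite Wd.sha]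
    (hr : W.mordellWeilRank + Wd.mordellWeilRank ≤ 1)
    (hS : ∀ v : HeightOneSpectrum (𝓞 ℚ), W.HasGoodReductionAt v ∨ W.HasMultiplicativeReductionAt v ∨
      (((primesEquiv v : ℕ) : ℤ) ∣ NumberField.discr K ∧ Wd.HasMultiplicativeReductionAt v) ∨
      (W.HasAdditiveReductionAt v ∧ ¬ ((primesEquiv v : ℕ) : ℤ) ∣ NumberField.discr K))
    (hp5 : 5 ≤ p) :
    ∃ q : ℚ, 0 < q ∧ padicValRat p q = 0 ∧
      (W'.shaOrder : ℝ) * W'.regulator * W'.bsdPeriod * (W'.tamagawaProduct : ℝ) /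
          (W'.torsionOrder : ℝ) ^ 2 = (q : ℝ) * (W.bsdRHS * Wd.bsdRHS) :=
  milneQuotient_ordp_of_unramifiedFact_imaginary W p K Wd W' h2 hdodd hdsq hWd hW' hr
    (unramifiedFact_rat W K) hS hp5

/-- **G-1 (real) WITHOUT `hA`: `hWR_p` on S₃ at `p ≥ 5`, real `K` (`hreal`), total rank `≤ 1`.**
[cite: Milne1972ArithmeticAV, §1 Thm. 1 and §2 (through DokchitserDokchitserAnnals2010, §2.1, proof of Thm. 8)] [cite: SilvermanAEC2009, Prop. VII.5.4 (a)] -/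
theorem milneQuotient_ordp_of_addv_unramified_real (h2 : Module.finrank ℚ K = 2)
    (hreal : IsTotallyReal K)
    (hdodd : Odd (NumberField.discr K)) (hdsq : Squarefree (NumberField.discr K))
    {Cd : VariableChange ℚ} (hWd : Cd • W.quadraticTwist (NumberField.discr K : ℚ) = Wd)
    {C' : VariableChange K} (hW' : C' • W.baseChange K = W') [Finite W.sha] [Finite Wd.sha]
    (hr : W.mordellWeilRank + Wd.mordellWeilRank ≤ 1)
    (hS : ∀ v : HeightOneSpectrum (𝓞 ℚ), W.HasGoodReductionAt v ∨ W.HasMultiplicativeReductionAt v ∨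
      (((primesEquiv v : ℕ) : ℤ) ∣ NumberField.discr K ∧ Wd.HasMultiplicativeReductionAt v) ∨
      (W.HasAdditiveReductionAt v ∧ ¬ ((primesEquiv v : ℕ) : ℤ) ∣ NumberField.discr K))
    (hp5 : 5 ≤ p) :
    ∃ q : ℚ, 0 < q ∧ padicValRat p q = 0 ∧
      (W'.shaOrder : ℝ) * W'.regulator * W'.bsdPeriod * (W'.tamagawaProduct : ℝ) /
          (W'.torsionOrder : ℝ) ^ 2 = (q : ℝ) * (W.bsdRHS * Wd.bsdRHS) :=
  milneQuotient_ordp_of_unramifiedFact_real W p K Wd W' h2 hreal hdodd hdsq hWd hW' hr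
    (unramifiedFact_rat W K) hS hp5

/-- **THE S₃ END WITHOUT `hA`: base-change-and-descend with additive places `2`, `3` (away from
`p`) allowed, NO unproved hypothesis left besides the typed over-`K` input.**  For `W/ℚ` globally
minimal elliptic, `K` quadratic of EITHER signature with `d_K` odd squarefree (e.g. `ℚ(√p*)`),
globally minimal `W_d = C_d • W^{(d_K)}`, `W' = C' • W_K`, `W.analyticRank + Wd.analyticRank ≤ 1`,
`hS` = population S₃, `p ≥ 5`: **`BSDp W p ⟸ MissingPPartOverAt W' p ∧ BSDp Wd p`** (other
hypotheses: `hGZK`, `hmod`).  p01's `bsdp_of_pPartOver_of_bsdp_twist_quadratic_of_unramifiedFact`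
fed with `unramifiedFact_rat`: Milne's A65 is not used and A233 is now a theorem, so on S₃ the
descent rests on NO registry fact.
[cite: Milne1972ArithmeticAV, §1 Thm. 1 and §2 (through DokchitserDokchitserAnnals2010, §2.1, proof of Thm. 8)]
[cite: SilvermanAEC2009, Prop. VII.5.4 (a)] [cite: Miller2011LMS, Def. 1.1 (arXiv:1010.2431 p. 3)] -/
theorem bsdp_of_pPartOver_of_bsdp_twist_quadratic_of_addv_unramified
    (hGZK : rank_eq_analyticRank_of_analyticRank_le_one) (hmod : hasEntireLFunction_rat)
    (h2 : Module.finrank ℚ K = 2)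
    (hdodd : Odd (NumberField.discr K)) (hdsq : Squarefree (NumberField.discr K))
    {Cd : VariableChange ℚ} (hWd : Cd • W.quadraticTwist (NumberField.discr K : ℚ) = Wd)
    {C' : VariableChange K} (hW' : C' • W.baseChange K = W')
    (hr : W.analyticRank + Wd.analyticRank ≤ 1)
    (hS : ∀ v : HeightOneSpectrum (𝓞 ℚ), W.HasGoodReductionAt v ∨ W.HasMultiplicativeReductionAt v ∨
      (((primesEquiv v : ℕ) : ℤ) ∣ NumberField.discr K ∧ Wd.HasMultiplicativeReductionAt v) ∨
      (W.HasAdditiveReductionAt v ∧ ¬ ((primesEquiv v : ℕ) : ℤ) ∣ NumberField.discr K))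
    (hp5 : 5 ≤ p) (hK : MissingPPartOverAt W' p) (hd : BSDp Wd p) : BSDp W p :=
  bsdp_of_pPartOver_of_bsdp_twist_quadratic_of_unramifiedFact W p K Wd W' hGZK hmod h2 hdodd hdsq hWd
    hW' hr (unramifiedFact_rat W K) hS hp5 hK hd

end Unramified

end Summit.BirchSwinnertonDyer.Rank1Residual.AdditivePotMult

end
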